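import Mathlib
import Summits.Ventures.PercRepro.TriangleCapThreeBelowDiagonalTwelve
import Summits.Ventures.PercRepro.TriangleCapThreeBelowFourTrianglesC
import Summits.Ventures.PercRepro.TriangleCapThreeBelowOneTriangleE

/-!
# PercRepro — THREE BELOW THE DIAGONAL IS EXACT ON THE `K₄⁻`-FREE CLASS FOR EVERY `k ≥ 10` (p3, gen 38; part 111)

**`dense_stability_three_of_ten`**: a `K₄⁻`-free graph on `k ≥ 10` vertices with `2m ≥ 6k − 24` edges,
`2m ≠ 6k − 20`, (`k ≥ 12` or `2m = 6k − 24` or `k ≥ 11 ∧ 2m ≤ 6k − 16`), not bipartite spanning with at most two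
missing cross pairs, has `Σ_v d(v)² + 3 (k − 4) ≤ m k` — as `dense_stability_three_of_twelve` (part 106), with the
one-triangle residue widened to `(11, 25)` (part 110), exactly four triangles by the transversal count (parts
107–109) and five or more by the envelope (`stability_of_triangles` with `j = 5`: `3 (k − 4) ≤ 5 (k − 6)` from
`k = 9`).  **`three_below_diagonal_exact_k4m_of_ten`**: for `k ≥ 10`, `m = a (k − a) − 3 ≥ 2k − 3` with
`m, m + 1, m + 2` not products `a′ (k − a′)`, the maximum of `2·Σ_v C(d(v), 2)` over the `K₄⁻`-free graphs on
`Fin k` with `m` edges IS `m (k − 2) − 3 (k − 4)`; the arithmetic of the cells at `k = 10, 11` (`cell_arith_ten`):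
`(10, 18)`, `(11, 21)` (`a = 3`) and `(11, 25)` (`a = 4`) — `(10, 21)`, `(10, 22)`, `(11, 27)` are excluded by the
product conditions.  The cells `(10, 18) 63 · (11, 21) 84 · (11, 25) 102` by name.  Axioms: standard.
-/

namespace PercRepro

namespace TriangleCap

namespace C047

open Finset

variable {V : Type*} [Fintype V] [DecidableEq V]

/-- **THE `r = 3` STABILITY OF THE DENSE CORNER FOR `k ≥ 10`.** -/
theorem dense_stability_three_of_ten (D : SimpleGraph V) [DecidableRel D.Adj] (hK : K4mFree D)
    (hk : 10 ≤ Fintype.card V) (hm : 6 * Fintype.card V ≤ 2 * D.edgeFinset.card + 24)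
    (hm' : 2 * D.edgeFinset.card + 20 ≠ 6 * Fintype.card V)
    (hcell : 12 ≤ Fintype.card V ∨ 2 * D.edgeFinset.card + 24 = 6 * Fintype.card V ∨
      (11 ≤ Fintype.card V ∧ 2 * D.edgeFinset.card + 16 ≤ 6 * Fintype.card V))
    (hnot : ¬ ∃ A : Finset V, (∀ x y, D.Adj x y → (x ∈ A ↔ y ∉ A)) ∧ (missing D A Aᶜ).card ≤ 2) :
    ∑ v, deg D v * deg D v + 3 * (Fintype.card V - 4) ≤ D.edgeFinset.card * Fintype.card V := by
  have hm2 : 2 * Fintype.card V ≤ D.edgeFinset.card + 3 := by omega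
  by_cases hfree : D.CliqueFree 3
  · exact triangle_free_stability_three D hfree hm2 hnot
  obtain ⟨S, hS⟩ := not_forall.mp hfree
  have hS' := not_not.mp hS
  rw [SimpleGraph.is3Clique_iff] at hS'
  obtain ⟨u, v, w, huv, huw, hvw, -⟩ := hS'
  by_cases hT : ∀ a b c, D.Adj a b → D.Adj a c → D.Adj b c → a = u ∨ a = v ∨ a = w
  · -- ONE TRIANGLE: by the number of outer vertices
    set Q : Finset V := (({u, v, w} : Finset V)ᶜ).filter (fun z => degIn D {u, v, w} z = 0) with hQ
    rcases Nat.lt_or_ge Q.card 2 with hQ2 | hQ2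
    · rcases Nat.eq_zero_or_pos Q.card with hQ0 | hQ1
      · have hq : ∀ z, z ∉ ({u, v, w} : Finset V) → 1 ≤ degIn D {u, v, w} z := by
          intro z hz
          by_contra h0
          have hzQ : z ∈ Q := by
            rw [hQ, mem_filter, mem_compl]
            exact ⟨hz, by omega⟩
          rw [card_eq_zero] at hQ0
          rw [hQ0] at hzQ
          exact notMem_empty z hzQ
        exact one_triangle_stability_three_no_outer' D hK huv huw hvw hT hq (by omega) hm hm' hcell
      · have hQ1' : Q.card = 1 := by omega
        obtain ⟨z, hz⟩ := card_eq_one.mp hQ1'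
        have hzQ : z ∈ Q := by rw [hz]; exact mem_singleton_self z
        rw [hQ, mem_filter, mem_compl] at hzQ
        have hq : ∀ y, y ∉ ({u, v, w} : Finset V) → y ≠ z → 1 ≤ degIn D {u, v, w} y := by
          intro y hy hyz
          by_contra h0
          have hyQ : y ∈ Q := by
            rw [hQ, mem_filter, mem_compl]
            exact ⟨hy, by omega⟩
          rw [hz, mem_singleton] at hyQ
          exact hyz hyQ
        exact one_triangle_stability_three_of_one_outer D hK huv huw hvw hT hzQ.1 hzQ.2 hq (by omega)
    · exact one_triangle_stability_three_of_outer D hK huv huw hvw hT hm (by rw [← hQ]; omega)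
  simp only [not_forall, not_or] at hT
  obtain ⟨a, b, c, hab, hac, hbc, hau, hav, haw⟩ := hT
  have ha : ¬ (a = u ∨ a = v ∨ a = w) := fun h => by
    rcases h with h | h | h
    · exact hau h
    · exact hav h
    · exact haw h
  by_cases hT3 : ∀ x y z, D.Adj x y → D.Adj x z → D.Adj y z → x = u ∨ x = v ∨ x = w ∨ x = a ∨ x = b ∨ x = c
  · -- TWO TRIANGLES
    by_cases hdisj : ∀ t, (t = u ∨ t = v ∨ t = w) → ¬ (t = a ∨ t = b ∨ t = c)
    · exact two_triangles_stability_three_of_disjoint D hK (by omega) hm huv huw hvw hab hac hbc hT3 hdisj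
    · simp only [not_forall, not_not, exists_prop] at hdisj
      obtain ⟨t, ht1, ht2⟩ := hdisj
      exact two_triangles_stability_three_of_shared D hK hk hm huv huw hvw hab hac hbc ha hT3 ⟨ht1, ht2⟩
  simp only [not_forall, not_or] at hT3
  obtain ⟨x, y, z, hxy, hxz, hyz, hxu, hxv, hxw, hxa, hxb, hxc⟩ := hT3
  have hx : ¬ (x = u ∨ x = v ∨ x = w ∨ x = a ∨ x = b ∨ x = c) := fun h => by
    rcases h with h | h | h | h | h | h
    · exact hxu h
    · exact hxv h
    · exact hxw h
    · exact hxa h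
    · exact hxb h
    · exact hxc h
  set T₁ : Finset V := {u, v, w} with hT₁
  set T₂ : Finset V := {a, b, c} with hT₂
  set T₃ : Finset V := {x, y, z} with hT₃
  by_cases hT4 : ∀ x' y' z', D.Adj x' y' → D.Adj x' z' → D.Adj y' z' →
      (x' ∈ T₁ ∧ y' ∈ T₁) ∨ (x' ∈ T₂ ∧ y' ∈ T₂) ∨ (x' ∈ T₃ ∧ y' ∈ T₃)
  · -- THREE TRIANGLES
    exact three_triangles_stability_three_of_ten D hK hk hm huv huw hvw hab hac hbc hxy hxz hyz ha hx hT4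
  have h₁ : T₁.card = 3 := card_triple huv.ne huw.ne hvw.ne
  have h₂ : T₂.card = 3 := card_triple hab.ne hac.ne hbc.ne
  have h₃ : T₃.card = 3 := card_triple hxy.ne hxz.ne hyz.ne
  have hcl₁ := clique_triple D huv huw hvw
  have hcl₂ := clique_triple D hab hac hbc
  have hcl₃ := clique_triple D hxy hxz hyz
  have hx1 : ¬ (x = u ∨ x = v ∨ x = w) := fun h => hx (by tauto)
  have hx2 : ¬ (x = a ∨ x = b ∨ x = c) := fun h => hx (by tauto)
  have hi12 : (T₁ ∩ T₂).card ≤ 1 := inter_card_le_one_of_triangles D hK huv huw hvw hab hac hbc ha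
  have hi13 : (T₁ ∩ T₃).card ≤ 1 := inter_card_le_one_of_triangles D hK huv huw hvw hxy hxz hyz hx1
  have hi23 : (T₂ ∩ T₃).card ≤ 1 := inter_card_le_one_of_triangles D hK hab hac hbc hxy hxz hyz hx2
  simp only [not_forall, not_or] at hT4
  obtain ⟨x', y', z', hxy', hxz', hyz', h1, h2, h3⟩ := hT4
  set T₄ : Finset V := {x', y', z'} with hT₄
  have h₄ : T₄.card = 3 := card_triple hxy'.ne hxz'.ne hyz'.ne
  have hcl₄ := clique_triple D hxy' hxz' hyz'
  have hx'4 : x' ∈ T₄ := by rw [hT₄]; exact mem_insert_self _ _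
  have hy'4 : y' ∈ T₄ := by rw [hT₄]; exact mem_insert_of_mem (mem_insert_self _ _)
  have hne1 : T₄ ≠ T₁ := fun h => h1 ⟨h ▸ hx'4, h ▸ hy'4⟩
  have hne2 : T₄ ≠ T₂ := fun h => h2 ⟨h ▸ hx'4, h ▸ hy'4⟩
  have hne3 : T₄ ≠ T₃ := fun h => h3 ⟨h ▸ hx'4, h ▸ hy'4⟩
  have hne12 : T₁ ≠ T₂ := fun h => by rw [h, inter_self, h₂] at hi12; omega
  have hne13 : T₁ ≠ T₃ := fun h => by rw [h, inter_self, h₃] at hi13; omega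
  have hne23 : T₂ ≠ T₃ := fun h => by rw [h, inter_self, h₃] at hi23; omega
  by_cases hT5 : ∀ x'' y'' z'', D.Adj x'' y'' → D.Adj x'' z'' → D.Adj y'' z'' →
      (x'' ∈ T₁ ∧ y'' ∈ T₁) ∨ (x'' ∈ T₂ ∧ y'' ∈ T₂) ∨ (x'' ∈ T₃ ∧ y'' ∈ T₃) ∨ (x'' ∈ T₄ ∧ y'' ∈ T₄)
  · -- FOUR TRIANGLES
    exact four_triangles_stability_three_of_ten D hK hk hm T₁ T₂ T₃ T₄ h₁ h₂ h₃ h₄ hcl₁ hcl₂ hcl₃ hcl₄ hne12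
      hne13 (Ne.symm hne1) hne23 (Ne.symm hne2) (Ne.symm hne3) hT5
  -- FIVE OR MORE: `|T₃| ≥ 30` and the envelope
  simp only [not_forall, not_or] at hT5
  obtain ⟨x'', y'', z'', hxy'', hxz'', hyz'', g1, g2, g3, g4⟩ := hT5
  set T₅ : Finset V := {x'', y'', z''} with hT₅
  have hx''5 : x'' ∈ T₅ := by rw [hT₅]; exact mem_insert_self _ _
  have hy''5 : y'' ∈ T₅ := by rw [hT₅]; exact mem_insert_of_mem (mem_insert_self _ _)
  have hne51 : T₅ ≠ T₁ := fun h => g1 ⟨h ▸ hx''5, h ▸ hy''5⟩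
  have hne52 : T₅ ≠ T₂ := fun h => g2 ⟨h ▸ hx''5, h ▸ hy''5⟩
  have hne53 : T₅ ≠ T₃ := fun h => g3 ⟨h ▸ hx''5, h ▸ hy''5⟩
  have hne54 : T₅ ≠ T₄ := fun h => g4 ⟨h ▸ hx''5, h ▸ hy''5⟩
  have hF : ({T₁, T₂, T₃, T₄, T₅} : Finset (Finset V)).card = 5 := by
    rw [card_insert_of_notMem, card_insert_of_notMem, card_insert_of_notMem, card_insert_of_notMem,
      card_singleton]
    · rw [mem_singleton]; exact Ne.symm hne54
    · rw [mem_insert, mem_singleton, not_or]; exact ⟨Ne.symm hne3, Ne.symm hne53⟩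
    · rw [mem_insert, mem_insert, mem_singleton, not_or, not_or]; exact ⟨hne23, Ne.symm hne2, Ne.symm hne52⟩
    · rw [mem_insert, mem_insert, mem_insert, mem_singleton, not_or, not_or, not_or]
      exact ⟨hne12, hne13, Ne.symm hne1, Ne.symm hne51⟩
  have h30 := six_mul_card_le_card_triangles3 D {T₁, T₂, T₃, T₄, T₅} (by
    intro T hT'
    simp only [mem_insert, mem_singleton] at hT'
    rcases hT' with rfl | rfl | rfl | rfl | rfl
    · exact ⟨u, v, w, huv, huw, hvw, rfl⟩
    · exact ⟨a, b, c, hab, hac, hbc, rfl⟩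
    · exact ⟨x, y, z, hxy, hxz, hyz, rfl⟩
    · exact ⟨x', y', z', hxy', hxz', hyz', rfl⟩
    · exact ⟨x'', y'', z'', hxy'', hxz'', hyz'', rfl⟩)
  rw [hF] at h30
  have h := stability_of_triangles D hK (by omega) 5 3 (by omega) (by omega)
  have e : Fintype.card V - 3 - 1 = Fintype.card V - 4 := by omega
  rw [e] at h
  exact h

omit [Fintype V] [DecidableEq V] in
/-- The cells three below the diagonal at `k = 10, 11`: `(10, 18)`, `(11, 21)` and `(11, 25)`. -/
theorem cell_arith_ten (k a : ℕ) (hk : k = 10 ∨ k = 11) (hak : a ≤ k) (hdense : 2 * k ≤ a * (k - a))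
    (hm : ∀ a', a' ≤ k → a * (k - a) - 3 ≠ a' * (k - a') ∧ a * (k - a) - 2 ≠ a' * (k - a') ∧
      a * (k - a) - 1 ≠ a' * (k - a')) :
    (k = 10 ∧ a * (k - a) = 21) ∨ (k = 11 ∧ a * (k - a) = 24) ∨ (k = 11 ∧ a * (k - a) = 28) := by
  rcases hk with rfl | rfl
  · interval_cases a
    all_goals first
      | (revert hdense; decide)
      | (have h3 := (hm 3 (by norm_num)).1; revert h3; decide)
      | (have h4 := (hm 4 (by norm_num)).2.2; revert h4; decide)
  · interval_cases a
    all_goals first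
      | (revert hdense; decide)
      | (have h4 := (hm 4 (by norm_num)).2.1; revert h4; decide)

/-- **THREE BELOW THE DIAGONAL IS EXACT ON THE `K₄⁻`-FREE CLASS FOR EVERY `k ≥ 10`.** -/
theorem three_below_diagonal_exact_k4m_of_ten (k a : ℕ) (hk : 10 ≤ k) (ha : 1 ≤ a) (hak : a + 3 ≤ k)
    (hdense : 2 * k ≤ a * (k - a) - 3 + 3)
    (hm : ∀ a', a' ≤ k → a * (k - a) - 3 ≠ a' * (k - a') ∧ a * (k - a) - 2 ≠ a' * (k - a') ∧
      a * (k - a) - 1 ≠ a' * (k - a')) :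
    (∀ (D : SimpleGraph (Fin k)) [DecidableRel D.Adj], K4mFree D →
        D.edgeFinset.card = a * (k - a) - 3 →
        2 * cherries D + 3 * (k - 4) ≤ (a * (k - a) - 3) * (k - 2)) ∧
      ∃ (D : SimpleGraph (Fin k)) (_ : DecidableRel D.Adj), K4mFree D ∧
        D.edgeFinset.card = a * (k - a) - 3 ∧ 2 * cherries D + 3 * (k - 4) = (a * (k - a) - 3) * (k - 2) := by
  rcases Nat.lt_or_ge k 12 with hk12 | hk12
  · have hka : 3 ≤ a * (k - a) := by
      obtain ⟨c, hc⟩ : ∃ c, k = a + 3 + c := ⟨k - a - 3, by omega⟩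
      subst hc
      have : a + 3 + c - a = 3 + c := by omega
      rw [this]
      nlinarith
    have hcell := cell_arith_ten k a (by omega) (by omega) (by omega) hm
    obtain ⟨m, hmm⟩ : ∃ m, a * (k - a) = m + 3 := ⟨a * (k - a) - 3, by omega⟩
    have e1 : a * (k - a) - 3 = m := by omega
    have e2 : a * (k - a) - 2 = m + 1 := by omega
    have e3 : a * (k - a) - 1 = m + 2 := by omega
    rw [e1] at hdense hm ⊢
    rw [e2, e3] at hm
    rw [hmm] at hcell
    constructor
    · intro D _ hK hD
      have hcard : Fintype.card (Fin k) = k := Fintype.card_fin k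
      have hnot : ¬ ∃ A : Finset (Fin k), (∀ x y, D.Adj x y → (x ∈ A ↔ y ∉ A)) ∧ (missing D A Aᶜ).card ≤ 2 := by
        rintro ⟨A, hA, hN⟩
        have hNX := card_missing_add_card_edges D A hA
        have hXc : Aᶜ.card = k - A.card := by
          have := card_add_card_compl A
          rw [hcard] at this
          omega
        have hXk : A.card ≤ k := by
          have := card_le_univ A
          rwa [hcard] at this
        obtain ⟨h1, h2, h3⟩ := hm A.card hXk
        rw [hXc, hD] at hNX
        have : (missing D A Aᶜ).card = 0 ∨ (missing D A Aᶜ).card = 1 ∨ (missing D A Aᶜ).card = 2 := by omega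
        rcases this with h | h | h
        · rw [h] at hNX; exact h1 (by omega)
        · rw [h] at hNX; exact h2 (by omega)
        · rw [h] at hNX; exact h3 (by omega)
      have h1 := dense_stability_three_of_ten D hK (by rw [hcard]; exact hk) (by rw [hcard, hD]; omega)
        (by rw [hcard, hD]; omega) (by rw [hcard, hD]; omega) hnot
      have h2 := two_mul_cherries_add D
      have h3 := sum_deg_eq D
      rw [hcard, hD] at h1
      rw [hD] at h3
      obtain ⟨k', hk'⟩ : ∃ k', k = k' + 4 := ⟨k - 4, by omega⟩
      subst hk'
      have e4 : k' + 4 - 4 = k' := by omega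
      have e5 : k' + 4 - 2 = k' + 2 := by omega
      rw [e4] at h1 ⊢
      rw [e5]
      nlinarith
    · refine ⟨bipMinusStar k a 3, inferInstance, k4mFree_bipMinusStar k a 3, ?_, ?_⟩
      · have := card_edges_bipMinusStar k a 3 ha hak
        omega
      · have h := two_mul_cherries_bipMinusStar k a 3 ha hak (by omega)
        rw [hmm] at h
        obtain ⟨k', hk'⟩ : ∃ k', k = k' + 4 := ⟨k - 4, by omega⟩
        subst hk'
        have e4 : k' + 4 - 4 = k' := by omega
        have e5 : k' + 4 - 2 = k' + 2 := by omega
        have e6 : 2 * (k' + 4) - 3 - 3 = 2 * k' + 2 := by omega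
        rw [e5, e6] at h
        rw [e4, e5]
        nlinarith
  · exact three_below_diagonal_exact_k4m_of_twelve k a hk12 ha hak hdense hm

/-- The cell `(10, 18)` on `K₄⁻`-free graphs (`18 = 3·7 − 3`; `18, 19, 20` are not products `a′(10 − a′)`):
`2·cherries ≤ 126`, attained. -/
theorem cell_ten_eighteen_k4m :
    (∀ (D : SimpleGraph (Fin 10)) [DecidableRel D.Adj], K4mFree D → D.edgeFinset.card = 18 →
      2 * cherries D ≤ 126) ∧
    ∃ (D : SimpleGraph (Fin 10)) (_ : DecidableRel D.Adj), K4mFree D ∧ D.edgeFinset.card = 18 ∧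
      2 * cherries D = 126 := by
  have h := three_below_diagonal_exact_k4m_of_ten 10 3 (by norm_num) (by norm_num) (by norm_num) (by norm_num)
    (by decide)
  have e1 : 3 * (10 - 3) - 3 = 18 := by norm_num
  have e2 : (3 * (10 - 3) - 3) * (10 - 2) = 144 := by norm_num
  have e3 : 3 * (10 - 4) = 18 := by norm_num
  rw [e1, e2, e3] at h
  obtain ⟨h1, D, inst, h2, h3, h4⟩ := h
  exact ⟨fun D _ hK hD => by have := h1 D hK hD; omega, D, inst, h2, h3, by omega⟩

/-- The cell `(11, 21)` on `K₄⁻`-free graphs (`21 = 3·8 − 3`; `21, 22, 23` are not products `a′(11 − a′)`):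
`2·cherries ≤ 168`, attained. -/
theorem cell_eleven_twentyone_k4m :
    (∀ (D : SimpleGraph (Fin 11)) [DecidableRel D.Adj], K4mFree D → D.edgeFinset.card = 21 →
      2 * cherries D ≤ 168) ∧
    ∃ (D : SimpleGraph (Fin 11)) (_ : DecidableRel D.Adj), K4mFree D ∧ D.edgeFinset.card = 21 ∧
      2 * cherries D = 168 := by
  have h := three_below_diagonal_exact_k4m_of_ten 11 3 (by norm_num) (by norm_num) (by norm_num) (by norm_num)
    (by decide)
  have e1 : 3 * (11 - 3) - 3 = 21 := by norm_num
  have e2 : (3 * (11 - 3) - 3) * (11 - 2) = 189 := by norm_num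
  have e3 : 3 * (11 - 4) = 21 := by norm_num
  rw [e1, e2, e3] at h
  obtain ⟨h1, D, inst, h2, h3, h4⟩ := h
  exact ⟨fun D _ hK hD => by have := h1 D hK hD; omega, D, inst, h2, h3, by omega⟩

/-- The cell `(11, 25)` on `K₄⁻`-free graphs (`25 = 4·7 − 3`; `25, 26, 27` are not products `a′(11 − a′)`):
`2·cherries ≤ 204`, attained. -/
theorem cell_eleven_twentyfive_k4m :
    (∀ (D : SimpleGraph (Fin 11)) [DecidableRel D.Adj], K4mFree D → D.edgeFinset.card = 25 →
      2 * cherries D ≤ 204) ∧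
    ∃ (D : SimpleGraph (Fin 11)) (_ : DecidableRel D.Adj), K4mFree D ∧ D.edgeFinset.card = 25 ∧
      2 * cherries D = 204 := by
  have h := three_below_diagonal_exact_k4m_of_ten 11 4 (by norm_num) (by norm_num) (by norm_num) (by norm_num)
    (by decide)
  have e1 : 4 * (11 - 4) - 3 = 25 := by norm_num
  have e2 : (4 * (11 - 4) - 3) * (11 - 2) = 225 := by norm_num
  have e3 : 3 * (11 - 4) = 21 := by norm_num
  rw [e1, e2, e3] at h
  obtain ⟨h1, D, inst, h2, h3, h4⟩ := h
  exact ⟨fun D _ hK hD => by have := h1 D hK hD; omega, D, inst, h2, h3, by omega⟩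

end C047

end TriangleCap

end PercRepro
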